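import Summits.Ventures.CertifiedArithmetic.LowPrec.DoubleRoundingGmidBelow

/-!
# Double rounding at a general midpoint — the tie of the wide format, from below

HONEST FRAMING: certified error envelopes and provably optimal rounding/accumulation schemes for
low-precision formats under stated cost models; every table by two implementations; no hardware
or vendor claims.

`DoubleRoundingGmidBelow.lean` §2 treats `x = μ + δ` with `2δ` EQUAL to the spacing of the wide
format `ψ` at the midpoint `μ = (2t+1)·2^k` quanta of two consecutive values
`t·2^(k+1) < (t+1)·2^(k+1)` of the normal range of `φ`: `fl_ψ x = μ` because `μ` is an EVEN
datum of `ψ` ([BoldoMelquiond2008] Thm 3) while the other candidate `μ + 2δ` is odd.  This file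
is the MIRROR: at `x = μ - δ` the two candidates are `μ - 2δ` (ODD in `ψ`) and `μ` (even), so
again `fl_ψ x = μ` (`toRat_roundNE_wide_gmid_tie_below`); with `t` ODD the tie of `φ` at `μ`
goes UP to the even neighbour `(t+1)·2^(k+1)` (`toRat_roundNE_gmid_odd`) while the truth
`fl_φ (μ - δ)` is DOWN at `t·2^(k+1)` (`toRat_roundNE_below_gmid`):
`roundNE_roundNE_ne_gmid_tie_below`.  It is the last of the four sign/parity cases of the
general-midpoint slip (above/below × strict/tie) and serves the FMA witnesses of THEOREM D-fma-W
(`DoubleRoundingFMAWide*.lean`: `a·b = μ` exactly, `c = -quantum φ`, when the factorable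
midpoint has an odd lower neighbour).

References: [BoldoMelquiond2008] Thm 3, §III.A (parity along the grid);
[MartinDorelMelquiondMuller2013] Property 2.1 (a slip forces the intermediate onto a midpoint;
these lemmas are the converse construction at a prescribed midpoint); [Figueroa1995] §3.
-/

namespace Summit.Ventures.CertifiedArithmetic

open Literature.ComputerArithmetic.FloatingPoint
open Literature.ComputerArithmetic.FloatingPoint.Format
open Literature.ComputerArithmetic.FloatingPoint.MiniFloat

/-! ## §1 The tie of the wide format, from below -/

/-- AT A TIE OF THE WIDE FORMAT THE MIDPOINT WINS, FROM BELOW: under the range hypotheses of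
`toRat_roundNE_wide_gmid` with `m_φ + 2 ≤ m_ψ`, if `2δ` EQUALS
`2^(P_φ+k+d-P_ψ) · 2 · quantum ψ` (the spacing of `ψ` just below `μ`), then `fl_ψ (μ - δ) = μ`:
the two candidates are `μ - 2δ` and `μ`;
`μ = (2t+1)·2^(k+d)` quanta of `ψ` is a multiple of `2^(r+2)`, twice the spacing `2^(r+1)`
(`r + 2 ≤ k + d` is `m_φ + 2 ≤ m_ψ`), so `μ` is EVEN in `ψ` and `μ - 2^(r+1)` — still in the
binade of `μ`, because `2t+1 > 2^P_φ` — is odd. [cite: BoldoMelquiond2008, Thm 3] -/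
theorem toRat_roundNE_wide_gmid_tie_below {φ ψ : Format} (hq : ψ.qexp ≤ φ.qexp)
    (hM : φ.maxScaled * 2 ^ (φ.qexp - ψ.qexp).toNat ≤ ψ.maxScaled) (h1ψ : 1 ≤ ψ.manBits)
    (hP2 : φ.manBits + 2 ≤ ψ.manBits) {t k : ℕ} (htlo : 2 ^ φ.manBits ≤ t)
    (hthi : t < 2 ^ (φ.manBits + 1)) (hu : (t + 1) * 2 ^ (k + 1) ≤ φ.maxScaled)
    (hk' : ψ.manBits ≤ φ.manBits + k + (φ.qexp - ψ.qexp).toNat) {δ : ℚ}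
    (hδψ : 2 * δ
      = 2 ^ (φ.manBits + k + (φ.qexp - ψ.qexp).toNat + 1 - ψ.manBits) * ψ.quantum) :
    (roundNE ψ ((((2 * t + 1) * 2 ^ k : ℕ) : ℚ) * φ.quantum - δ)).toRat
      = (((2 * t + 1) * 2 ^ k : ℕ) : ℚ) * φ.quantum := by
  have hqφ := φ.quantum_pos
  have hqψ := ψ.quantum_pos
  set d := (φ.qexp - ψ.qexp).toNat with hd
  set n : ℕ := (2 * t + 1) * 2 ^ k with hn
  have hnle : n ≤ 2 ^ (ψ.manBits + 1 + k) := by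
    have h2 : 2 * t + 1 ≤ 2 ^ (φ.manBits + 2) := by
      rw [show φ.manBits + 2 = (φ.manBits + 1) + 1 by ring, pow_succ]; omega
    have h3 : 2 ^ (φ.manBits + 2) ≤ 2 ^ (ψ.manBits + 1) :=
      Nat.pow_le_pow_right (by norm_num) (by omega)
    calc n = (2 * t + 1) * 2 ^ k := hn
      _ ≤ 2 ^ (ψ.manBits + 1) * 2 ^ k := Nat.mul_le_mul_right _ (le_trans h2 h3)
      _ = 2 ^ (ψ.manBits + 1 + k) := by rw [← pow_add]
  have hn2 : n + 2 ^ k ≤ (t + 1) * 2 ^ (k + 1) := by rw [hn, pow_succ]; nlinarith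
  have hnmax : n ≤ φ.maxScaled := le_trans (Nat.le_add_right _ _) (le_trans hn2 hu)
  obtain ⟨zμ, hzμ⟩ := exists_toRat_eq_natMul_of_dvd hq hM (g := k) (n := n)
    ⟨2 * t + 1, by rw [hn]; ring⟩ hnle hnmax
  have hquant : φ.quantum = 2 ^ d * ψ.quantum := quantum_eq_two_pow_mul hq
  have hzμ' : zμ.toRat = ((n * 2 ^ d : ℕ) : ℚ) * ψ.quantum := by
    rw [hzμ, hquant]; push_cast; ring
  have hS : zμ.scaledMag = n * 2 ^ d := scaledMag_eq_of_toRat_eq hzμ'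
  obtain ⟨r, hr⟩ := Nat.exists_eq_add_of_le hk'
  have h5 : 2 ^ (ψ.manBits + 1 + r) = 2 ^ (φ.manBits + 1) * 2 ^ k * 2 ^ d := by
    rw [← pow_add, ← pow_add]; congr 1; omega
  -- strict version of the binade bound: `2t + 1 ≥ 2^P_φ + 1`
  have hlow : 2 ^ (ψ.manBits + 1 + r) + 2 ^ (k + d) ≤ n * 2 ^ d := by
    have h2 : 2 ^ (φ.manBits + 1) + 1 ≤ 2 * t + 1 := by rw [pow_succ]; omega
    calc 2 ^ (ψ.manBits + 1 + r) + 2 ^ (k + d)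
        = (2 ^ (φ.manBits + 1) + 1) * (2 ^ k * 2 ^ d) := by rw [h5, pow_add]; ring
      _ ≤ (2 * t + 1) * (2 ^ k * 2 ^ d) := Nat.mul_le_mul_right _ h2
      _ = n * 2 ^ d := by rw [hn]; ring
  have hexp : φ.manBits + k + d + 1 - ψ.manBits = r + 1 := by omega
  rw [hexp] at hδψ
  have hδ0 : 0 < δ := by
    have : (0 : ℚ) < 2 ^ (r + 1) * ψ.quantum := by positivity
    linarith
  -- `2^(r+2) ∣ n 2^d` (`r + 2 ≤ k + d` is `m_φ + 2 ≤ m_ψ`)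
  have hrk : r + 2 ≤ k + d := by omega
  have hdvd : 2 ^ (r + 2) ∣ n * 2 ^ d := by
    obtain ⟨c, hc⟩ := Nat.exists_eq_add_of_le hrk
    exact ⟨(2 * t + 1) * 2 ^ c, by rw [hn, mul_assoc, ← pow_add, hc, pow_add]; ring⟩
  have h6 : 2 ^ (r + 1) ≤ 2 ^ (k + d) := Nat.pow_le_pow_right (by norm_num) (by omega)
  -- the lower candidate `μ - 2^(r+1)` quanta of `ψ` is a datum `zl`, in the binade of `μ`
  set N : ℕ := n * 2 ^ d - 2 ^ (r + 1) with hN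
  have hNn : N + 2 ^ (r + 1) = n * 2 ^ d := by
    have : 2 ^ (r + 1) ≤ n * 2 ^ d := le_trans h6 (le_trans (Nat.le_add_left _ _) hlow)
    rw [hN]; omega
  have hNlow : 2 ^ (ψ.manBits + 1 + r) ≤ N := by rw [hN]; omega
  have hnd : n * 2 ^ d ≤ 2 ^ (ψ.manBits + 1 + (r + 1)) := by
    have h71 : 2 * t + 1 ≤ 2 * 2 ^ (φ.manBits + 1) := by omega
    calc n * 2 ^ d = (2 * t + 1) * (2 ^ k * 2 ^ d) := by rw [hn]; ring
      _ ≤ 2 * 2 ^ (φ.manBits + 1) * (2 ^ k * 2 ^ d) := Nat.mul_le_mul_right _ h71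
      _ = 2 ^ (ψ.manBits + 1 + (r + 1)) := by
          rw [show ψ.manBits + 1 + (r + 1) = (ψ.manBits + 1 + r) + 1 by ring,
            pow_succ 2 (ψ.manBits + 1 + r), h5]; ring
  have hNrep : ψ.Representable N := by
    refine representable_of_pow_dvd (g := r + 1) ?_ ?_ ?_
    · have h8 : 2 ^ (r + 1) ∣ n * 2 ^ d := dvd_trans (pow_dvd_pow 2 (by omega)) hdvd
      rw [hN]; exact Nat.dvd_sub h8 dvd_rfl
    · have := Nat.two_pow_pos (r + 1)
      rw [hN]; omega
    · have h8 : n * 2 ^ d ≤ φ.maxScaled * 2 ^ d := Nat.mul_le_mul_right _ hnmax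
      have := Nat.two_pow_pos (r + 1)
      rw [hN]; omega
  obtain ⟨zl, hzl⟩ := exists_toRat_eq_natMul hNrep
  have hNq : (N : ℚ) = (n : ℚ) * 2 ^ d - 2 ^ (r + 1) := by
    have h := hNn
    have h' : ((N + 2 ^ (r + 1) : ℕ) : ℚ) = ((n * 2 ^ d : ℕ) : ℚ) := by rw [h]
    push_cast at h'
    linarith
  have hzl' : zl.toRat = (n : ℚ) * φ.quantum - 2 * δ := by
    rw [hzl, hNq, hδψ, hquant]; ring
  have hzl0 : 0 ≤ zl.toRat := by rw [hzl]; positivity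
  have hSl0 : zl.scaledMag = N := scaledMag_eq_of_toRat_eq hzl
  set x := (n : ℚ) * φ.quantum - δ with hx
  -- `fl_ψ x` is `μ` or `μ - 2δ`
  have hnear := roundNE_nearest (φ := ψ) x zμ
  rw [hzμ, show x - (n : ℚ) * φ.quantum = -δ by rw [hx]; ring, abs_neg, abs_of_pos hδ0]
    at hnear
  have hab := abs_le.mp hnear
  have hor : (roundNE ψ x).toRat = zμ.toRat ∨ (roundNE ψ x).toRat = zl.toRat := by
    rcases lt_trichotomy (roundNE ψ x).toRat zμ.toRat with h | h | h
    · right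
      have hge : (n : ℚ) * φ.quantum - 2 * δ ≤ (roundNE ψ x).toRat := by
        rw [hx] at hab; linarith [hab.2]
      have hfl0 : 0 ≤ (roundNE ψ x).toRat := le_trans (by rw [← hzl']; exact hzl0) hge
      -- `fl_ψ x` lies in the binade of `μ`: its spacing is at least `2^(r+1)` quanta
      have hmag : zl.scaledMag ≤ (roundNE ψ x).scaledMag :=
        scaledMag_le_of_abs_le (by rw [abs_of_nonneg hzl0, abs_of_nonneg hfl0, hzl']; exact hge)
      have heu : r + 1 ≤ (roundNE ψ x).expCode - 1 := by
        apply succ_le_ulpExp_of_le_scaledMag (k := r)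
        rw [hSl0] at hmag; exact le_trans hNlow hmag
      have h1 := add_ulp_le_of_lt hfl0 h
      have hulp : (2 : ℚ) ^ (r + 1) ≤ 2 ^ ((roundNE ψ x).expCode - 1) :=
        pow_le_pow_right₀ (by norm_num) heu
      have h7 : (2 : ℚ) ^ (r + 1) * ψ.quantum ≤ 2 ^ ((roundNE ψ x).expCode - 1) * ψ.quantum :=
        mul_le_mul_of_nonneg_right hulp hqψ.le
      rw [hzμ] at h1
      have hle : (roundNE ψ x).toRat ≤ (n : ℚ) * φ.quantum - 2 * δ := by linarith
      rw [hzl']; exact le_antisymm hle hge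
    · exact Or.inl h
    · exfalso
      rw [hx, hzμ] at *
      linarith [hab.1]
  rcases hor with h | h
  · rw [hx] at h; rw [h, hzμ]
  · exfalso
    -- the lower candidate is ODD in `ψ`: an even winner would need `2^(r+2) ∣ N`
    have hev : 2 ∣ (roundNE ψ x).man :=
      roundNE_man_even_of_tie h1ψ (y := zμ)
        (by rw [h, hzμ, hzl', show x - (n : ℚ) * φ.quantum = -δ by rw [hx]; ring,
          show x - ((n : ℚ) * φ.quantum - 2 * δ) = δ by rw [hx]; ring, abs_neg])
        (by rw [h, hzμ, hzl']; intro heq; linarith)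
    rw [two_dvd_man_iff h1ψ] at hev
    have hSu : (roundNE ψ x).scaledMag = N := scaledMag_eq_of_toRat_eq (by rw [h, hzl])
    have heu : r + 1 ≤ (roundNE ψ x).expCode - 1 := by
      apply succ_le_ulpExp_of_le_scaledMag (k := r)
      rw [hSu]; exact hNlow
    rw [hSu] at hev
    obtain ⟨c, hc⟩ := Nat.exists_eq_add_of_le heu
    have h2 : 2 * 2 ^ ((roundNE ψ x).expCode - 1) = 2 ^ (r + 2) * 2 ^ c := by
      rw [hc, show r + 2 = (r + 1) + 1 by ring, pow_succ, pow_add]; ring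
    have h3 : 2 ^ (r + 2) ∣ N := dvd_trans (Dvd.intro _ h2.symm) hev
    have hdvd' : 2 ^ (r + 2) ∣ N + 2 ^ (r + 1) := by rw [hNn]; exact hdvd
    have h4 : 2 ^ (r + 2) ∣ 2 ^ (r + 1) := (Nat.dvd_add_right h3).mp hdvd'
    have h5' := Nat.le_of_dvd (by positivity) h4
    rw [pow_succ] at h5'
    have := Nat.two_pow_pos (r + 1)
    omega

/-! ## §2 The slip: `t` odd, `x` one half-spacing of `ψ` below the midpoint -/

/-- DOUBLE ROUNDING FAILS AT THE TIE OF THE WIDE FORMAT, FROM BELOW — for every pair of format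
records with `m_φ + 2 ≤ m_ψ` (and `P_φ ≥ 2`, `t` ODD): at `x = μ - δ` with `2δ` equal to the
spacing of `ψ` below `μ`, `fl_φ (fl_ψ x) = (t+1)·2^(k+1) ≠ t·2^(k+1) = fl_φ x` (quanta).
[cite: BoldoMelquiond2008, Thm 3] -/
theorem roundNE_roundNE_ne_gmid_tie_below {φ ψ : Format} (hq : ψ.qexp ≤ φ.qexp)
    (hM : φ.maxScaled * 2 ^ (φ.qexp - ψ.qexp).toNat ≤ ψ.maxScaled) (h1 : 1 ≤ φ.manBits)
    (hP2 : φ.manBits + 2 ≤ ψ.manBits) {t k : ℕ} (ht : Odd t) (htlo : 2 ^ φ.manBits ≤ t)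
    (hthi : t < 2 ^ (φ.manBits + 1)) (hu : (t + 1) * 2 ^ (k + 1) ≤ φ.maxScaled)
    (hk' : ψ.manBits ≤ φ.manBits + k + (φ.qexp - ψ.qexp).toNat) {δ : ℚ}
    (hδψ : 2 * δ
      = 2 ^ (φ.manBits + k + (φ.qexp - ψ.qexp).toNat + 1 - ψ.manBits) * ψ.quantum) :
    (roundNE φ (roundNE ψ ((((2 * t + 1) * 2 ^ k : ℕ) : ℚ) * φ.quantum - δ)).toRat).toRat
      ≠ (roundNE φ ((((2 * t + 1) * 2 ^ k : ℕ) : ℚ) * φ.quantum - δ)).toRat := by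
  have hqφ := φ.quantum_pos
  have hqψ := ψ.quantum_pos
  have hquant : φ.quantum = 2 ^ (φ.qexp - ψ.qexp).toNat * ψ.quantum :=
    quantum_eq_two_pow_mul hq
  have hδ0 : 0 < δ := by
    have : (0 : ℚ) < 2 ^ (φ.manBits + k + (φ.qexp - ψ.qexp).toNat + 1 - ψ.manBits)
        * ψ.quantum := by positivity
    linarith
  -- `δ < 2^k · quantum φ`: here `2δ ≤ 2^(k+d-1) · quantum ψ · 2 ≤ 2^k · quantum φ`
  have hδ : δ < 2 ^ k * φ.quantum := by
    have h2 : (2 : ℚ) ^ (φ.manBits + k + (φ.qexp - ψ.qexp).toNat + 1 - ψ.manBits) * 2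
        ≤ 2 ^ (k + (φ.qexp - ψ.qexp).toNat) := by
      rw [← pow_succ]; exact pow_le_pow_right₀ (by norm_num) (by omega)
    have h3 : (2 : ℚ) ^ (k + (φ.qexp - ψ.qexp).toNat) * ψ.quantum = 2 ^ k * φ.quantum := by
      rw [hquant, pow_add]; ring
    have h4 := mul_le_mul_of_nonneg_right h2 hqψ.le
    rw [h3] at h4
    nlinarith
  rw [toRat_roundNE_wide_gmid_tie_below hq hM (by omega) hP2 htlo hthi hu hk' hδψ,
    toRat_roundNE_gmid_odd h1 ht htlo hthi hu, toRat_roundNE_below_gmid htlo hthi hu hδ0 hδ]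
  intro h
  have h' := mul_right_cancel₀ hqφ.ne' h
  have h'' : (t + 1) * 2 ^ (k + 1) = t * 2 ^ (k + 1) := by exact_mod_cast h'
  have h3 := Nat.eq_of_mul_eq_mul_right (by positivity) h''
  omega

end Summit.Ventures.CertifiedArithmetic
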